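import Summits.RiemannHypothesis.RiemannHypothesis.Theorems.MotivicDoorTwoCarriers
import Summits.RiemannHypothesis.RiemannHypothesis.Theorems.MotivicDoorHodgeIndexCarrier
import Summits.RiemannHypothesis.RiemannHypothesis.Theorems.MotivicDoorEssayHypothesis
import Summits.RiemannHypothesis.RiemannHypothesis.Theorems.MotivicDoor.AWS.PrimeSideLattice
import Summits.RiemannHypothesis.RiemannHypothesis.Theorems.MotivicDoor.AWS.GeneratingFamilyForcing

/-!
# One located gap, three carriers — the arithmetic Weil surface joins the surface and curve carriers (motivic door, cc-3 gen 10)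

HONEST LABEL (verbatim on every AWS file).  One-way implication from a strengthened, prime-side-only
axiom system; the existence of such an object is NOT claimed and is the located gap; the converse
(RH ⇒ existence) is out of scope and, for this axiom system, tautological rather than informative
(HOME `AXIOM-CONTENT.md` §2; `AWS/Tautological`, `AWS/PrimeSideLattice`, `AWS/Skeleton`; REFEREE-1
B36/B39): `Nonempty ArithmeticWeilSurface` is a restatement of RH in structure clothing, NOT evidence
for RH.  Quoting the referee-signed verdict (HOME `AXIOM-CONTENT.md` §0) verbatim: "VERDICT (ref-1,
ref-2): `Nonempty ArithmeticWeilSurface` is a restatement of RH in structure clothing, not a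
different-looking hypothesis".  HONEST FRAMING: lottery ticket at the motivic door; RH probability
negligible; consolation prizes are real: a new semi-local Weil-positivity theorem, or a located gap in
the Connes–Consani programme, plus the ff-door theorem.

## What this file records

`Theorems/MotivicDoorTwoCarriers.lean` (cc-4, `located_objects_tfae`) printed the autopsy's ruling G11
"one located gap, two carriers" as a kernel theorem: the SURFACE carrier (a `WeilSurface` over `ℝ³`,
Weil 1948 / Mattuck–Tate / Grothendieck, Connes–Consani arXiv:1805.10501 §3) and the CURVE carrier
(Deninger's Hodge package `(θ, C, ∗, B)` on the multiplicity carrier, arXiv:2204.02714 §2) are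
equivalent as typed interfaces, to each other, to `WeilPositivity` and to RH.  AFTER that file landed,
the cell typed a THIRD carrier at the human's request — the INTEGRAL LATTICE carrier
`ArithmeticWeilSurface` of the AWS sprint (`Theorems/MotivicDoorAWSStructure.lean`: a `ℤ`-lattice with a
symmetric pairing, fibre classes `e₁² = e₂² = 0`, `e₁·e₂ = 1`, Frobenius-graph classes whose pairings are
the PRIME-side explicit-formula data of a `C¹`-dense generating family, and the Hodge-index sign field)
— together with three inequality-shaped readings of the same door on the test-function side:
Castelnuovo–Severi for every real divisor `D(f)` in the Connes–Consani normalisation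
(`MotivicDoorCastelnuovoSeveri`), the Hodge–Lefschetz data on `ℝ³` (`MotivicDoorHodgeIndexCarrier`),
and hypothesis (2) of Connes' 2016 essay on the pencil `D(f) + α ξ₀ + β ξ₁` (`MotivicDoorEssayHypothesis`);
and the sprint's forcing content in its sharpest form: positivity of Weil's functional on the INTEGER
SPAN of ONE `C¹`-dense family already decides RH (`AWS/GeneratingFamilyForcing`, `AWS/ForcingUp`).

`doors_tfae` below lists all NINE as one `List.TFAE` — kernel form of the bundle's verdict sentence
"every interface the cell typed is RH-equivalent; none is weaker, none is stronger":

1. `RiemannHypothesis`;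
2. `WeilPositivity` (Weil 1952; Bombieri 2000 Thm 2; `weil_criterion_holds`, in the tree);
3. SURFACE carrier: `Nonempty (WeilSurface (ℝ × ℝ × ℝ))` (`riemannHypothesis_iff_nonempty_weilSurface`);
4. Hodge–Lefschetz data on `ℝ³` (cc-3, `riemannHypothesis_iff_exists_hodge_lefschetz_data`);
5. Castelnuovo–Severi `2 𝔰(D(f),D(f)) ≤ 2 (∫ f d^*u)(∫ f du)` for every real `D(f)` (cc-3,
   `forall_ccPairing_le_masses_iff_riemannHypothesis`; arXiv:1805.10501 eq. (15)–(17) with the `−½` of §1);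
6. Connes' essay hypothesis (2) on the pencil (cc-3, `essayHypothesisTwo_iff_riemannHypothesis`;
   arXiv:1509.05576 §4 Lemma 2.1);
7. CURVE carrier: Deninger's complete package on the multiplicity carrier (cc-4,
   `riemannHypothesis_iff_exists_hodgePackage`);
8. LATTICE carrier: `Nonempty ArithmeticWeilSurface` (aws-3 forward `riemannHypothesis_of_arithmeticWeilSurface`
   = Hodge index on the lattice + density + RH-free continuity of the prime-side data ⇒ Weil positivity;
   aws-2 backward by the canonical prime-side carrier, `nonempty_arithmeticWeilSurface_iff_riemannHypothesis`);
9. FORCING, sharpest form: `∃ G : GeneratingFamily, ∀ c : G.ι →₀ ℤ, 0 ≤ Re W(u_c ⋆ ũ_c)` — the countably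
   many prime-side inequalities on the integer span of SOME `C¹`-dense family (cc-4
   `riemannHypothesis_iff_nonneg_on_generatingFamily` for every family; aws-2's explicit
   `monomialBumpFamily` makes the existential honest).

The four corollaries are the G11 sentences the paper prints for the third carrier (new statements;
each equivalence passes through `RiemannHypothesis`, exactly as in `MotivicDoorTwoCarriers`): the
lattice carrier exists iff the surface carrier exists, iff Deninger's package exists, iff
Castelnuovo–Severi holds for every real `D(f)`, iff some dense family carries the countable prime-side
positivity list.  The interfaces carry NO arithmetic; the whole content of the Connes–Consani /
Deninger / AWS lines is the CONSTRUCTION of carrier 3, 7 or 8 from a geometry of `Spec ℤ̄` (or an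
Arakelov-type lattice) with no input from the zeros and with the sign condition a THEOREM
(HOME `LOCATED-GAP.md` tests G1–G7 / T0–T5; `AXIOM-CONTENT.md` §2).  This is why the cell never presents
an axiom list as progress.

Honest grade: bookkeeping (compositions of landed theorems), PROVED in the kernel; no `def`, no named
`Prop` fact, no new axiom; nothing about `ζ` beyond Weil's criterion; RH probability unchanged
(negligible).
References: A. Weil (1952); E. Bombieri, *Problems of the Millennium: the Riemann Hypothesis* (2000)
Thm 2; A. Connes, C. Consani, arXiv:1805.10501 §1, §3, eq. (15)–(17); A. Connes, arXiv:1509.05576 §4;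
C. Deninger, arXiv:2204.02714 §2 (2.3)–(2.7); J.-P. Serre, Ann. of Math. 71 (1960) 392–394.
-/

-- lint debt (one line): the D-0017 layout forces the doubled path component `RiemannHypothesis.RiemannHypothesis`.
set_option linter.dupNamespace false

noncomputable section

open Complex Module Module.End
open scoped ComplexConjugate
open Literature.NumberTheory.LFunctions Literature.NumberTheory.Deninger2022
open Literature.NumberTheory.ConnesConsani2019
open Summit.RiemannHypothesis.RiemannHypothesis.Theorems
open Summit.RiemannHypothesis.RiemannHypothesis.Theorems.MotivicDoor.DeningerSpectrumModel
open Summit.RiemannHypothesis.RiemannHypothesis.Theorems.MotivicDoor.DeningerHodgeTwist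
open Summit.RiemannHypothesis.RiemannHypothesis.Theorems.MotivicDoor.DeningerPartner
open Summit.RiemannHypothesis.RiemannHypothesis.Theorems.MotivicDoor.DeningerHodgePackage
open Summit.RiemannHypothesis.RiemannHypothesis.Theorems.MotivicDoor.ConnesConsani
open Summit.RiemannHypothesis.RiemannHypothesis.Theorems.MotivicDoor.AWS

namespace Summit.RiemannHypothesis.RiemannHypothesis.Theorems.MotivicDoor.ThreeCarriers

/-- **One located gap, three carriers, nine doors.**  The Riemann Hypothesis; Weil positivity; the
surface carrier over `ℝ³`; the Hodge–Lefschetz data on `ℝ³`; Castelnuovo–Severi for every real divisor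
`D(f)` (Connes–Consani normalisation); Connes' essay hypothesis (2) on the pencil; Deninger's complete
Hodge package on the multiplicity carrier; the integral-lattice carrier `ArithmeticWeilSurface` of the
AWS sprint; and Weil positivity on the integer span of SOME `C¹`-dense generating family — all nine are
equivalent.  Every equivalence passes through `RiemannHypothesis`; the typed interfaces carry no
arithmetic (HOME `AXIOM-CONTENT.md` §0: "restatement of RH in structure clothing"). -/
theorem doors_tfae :
    List.TFAE
      [ _root_.RiemannHypothesis,
        WeilPositivity,
        Nonempty (WeilSurface (ℝ × ℝ × ℝ)),
        (∃ (I : LinearMap.BilinForm ℝ (ℝ × ℝ × ℝ)) (e₁ e₂ : ℝ × ℝ × ℝ) (corr : (ℝ → ℂ) → ℝ × ℝ × ℝ),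
          (∀ x y, I x y = I y x) ∧ I e₁ e₁ = 0 ∧ I e₂ e₂ = 0 ∧ I e₁ e₂ = 1 ∧
          (∀ g, IsWeilTest g → (∀ t, conj (g t) = g t) → I (corr g) e₁ = (weilMellin g 1).re) ∧
          (∀ g, IsWeilTest g → (∀ t, conj (g t) = g t) → I (corr g) e₂ = (weilMellin g 0).re) ∧
          (∀ g, IsWeilTest g → (∀ t, conj (g t) = g t) →
            I (corr g) (corr g) =
              2 * (weilMellin g 0).re * (weilMellin g 1).re - (weilQuadratic g).re) ∧
          ∀ D, I D (e₁ + e₂) = 0 → I D D ≤ 0),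
        (∀ u : ℝ → ℝ, IsWeilTest (fun t ↦ (u t : ℂ)) →
          2 * ccPairing (toMul u) (toMul u) ≤ 2 * (massDstar (toMul u) * massDu (toMul u))),
        (∀ u : ℝ → ℝ, IsWeilTest (fun t ↦ (u t : ℂ)) → ∀ α β : ℝ,
          0 < 2 * ccPairing (toMul u) (toMul u) + 2 * α * massDstar (toMul u) +
                2 * β * massDu (toMul u) + 2 * α * β →
            massDstar (toMul u) + β ≠ 0 ∨ massDu (toMul u) + α ≠ 0),
        (∃ (θ : End ℂ (MIndex →₀ ℂ)) (C : (MIndex →₀ ℂ) →ₗ[ℂ] (MIndex →₀ ℂ) →ₗ[ℂ] ℂ)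
          (star : (MIndex →₀ ℂ) →ₗ⋆[ℂ] (MIndex →₀ ℂ))
          (B : (MIndex →₀ ℂ) →ₗ[ℂ] (MIndex →₀ ℂ) →ₗ⋆[ℂ] ℂ),
          SpectrumAxiom θ ∧ CupLeibniz θ C ∧ CupPerfect θ C ∧ HodgeStar θ C star B),
        Nonempty ArithmeticWeilSurface,
        (∃ G : GeneratingFamily, ∀ c : G.ι →₀ ℤ,
          0 ≤ (weilQuadratic fun t ↦ (testCombination G.φ c t : ℂ)).re) ] := by
  tfae_have 1 ↔ 2 := (weil_criterion_holds : _root_.RiemannHypothesis ↔ WeilPositivity)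
  tfae_have 1 ↔ 3 := riemannHypothesis_iff_nonempty_weilSurface
  tfae_have 1 ↔ 4 := riemannHypothesis_iff_exists_hodge_lefschetz_data
  tfae_have 5 ↔ 1 := forall_ccPairing_le_masses_iff_riemannHypothesis
  tfae_have 6 ↔ 1 := essayHypothesisTwo_iff_riemannHypothesis
  tfae_have 1 ↔ 7 := riemannHypothesis_iff_exists_hodgePackage
  tfae_have 8 ↔ 1 := nonempty_arithmeticWeilSurface_iff_riemannHypothesis
  tfae_have 1 ↔ 9 :=
    ⟨fun h ↦ ⟨monomialBumpFamily, (riemannHypothesis_iff_nonneg_on_generatingFamily _).1 h⟩,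
      fun ⟨G, hG⟩ ↦ (riemannHypothesis_iff_nonneg_on_generatingFamily G).2 hG⟩
  tfae_finish

/-- One gap, three carriers (G11, third carrier) in one line: an arithmetic Weil surface (integral
lattice with Hodge index and prime-side Frobenius classes) exists iff a Weil surface over `ℝ³` exists. -/
theorem nonempty_arithmeticWeilSurface_iff_nonempty_weilSurface :
    Nonempty ArithmeticWeilSurface ↔ Nonempty (WeilSurface (ℝ × ℝ × ℝ)) :=
  doors_tfae.out 7 2

/-- Lattice carrier ⟷ curve carrier: an arithmetic Weil surface exists iff Deninger's complete Hodge
package `(θ, C, ∗, B)` exists on the multiplicity carrier. -/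
theorem nonempty_arithmeticWeilSurface_iff_exists_hodgePackage :
    Nonempty ArithmeticWeilSurface ↔
      ∃ (θ : End ℂ (MIndex →₀ ℂ)) (C : (MIndex →₀ ℂ) →ₗ[ℂ] (MIndex →₀ ℂ) →ₗ[ℂ] ℂ)
        (star : (MIndex →₀ ℂ) →ₗ⋆[ℂ] (MIndex →₀ ℂ))
        (B : (MIndex →₀ ℂ) →ₗ[ℂ] (MIndex →₀ ℂ) →ₗ⋆[ℂ] ℂ),
        SpectrumAxiom θ ∧ CupLeibniz θ C ∧ CupPerfect θ C ∧ HodgeStar θ C star B :=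
  doors_tfae.out 7 6

/-- **The inequality seat's closing sentence.**  The integral lattice with Hodge index exists iff the
would-be Castelnuovo–Severi inequality `2 𝔰(D(f), D(f)) ≤ 2 (∫ f d^*u)(∫ f du)` holds for EVERY real
divisor `D(f)` (Connes–Consani arXiv:1805.10501 eq. (15)–(17), `−½` normalisation of §1): the lattice
axioms do not weaken the inequality, they restate it. -/
theorem nonempty_arithmeticWeilSurface_iff_forall_castelnuovoSeveri :
    Nonempty ArithmeticWeilSurface ↔
      ∀ u : ℝ → ℝ, IsWeilTest (fun t ↦ (u t : ℂ)) →
        2 * ccPairing (toMul u) (toMul u) ≤ 2 * (massDstar (toMul u) * massDu (toMul u)) :=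
  doors_tfae.out 7 4

/-- **Forcing, sharpest form.**  An arithmetic Weil surface exists iff SOME `C¹`-dense generating family
carries the countably many prime-side inequalities `Re W(u_c ⋆ ũ_c) ≥ 0`, `c : G.ι →₀ ℤ` — density
upgrades positivity on one integer span to Weil positivity (`AWS/GeneratingFamilyForcing`), and the
canonical prime-side carrier (`AWS/PrimeSideLattice`) turns that span into the lattice. -/
theorem nonempty_arithmeticWeilSurface_iff_exists_generatingFamily_nonneg :
    Nonempty ArithmeticWeilSurface ↔
      ∃ G : GeneratingFamily, ∀ c : G.ι →₀ ℤ,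
        0 ≤ (weilQuadratic fun t ↦ (testCombination G.φ c t : ℂ)).re :=
  doors_tfae.out 7 8

/-- Surface-side reading of the Hodge–Lefschetz data: the decreed Lefschetz data live on SOME carrier of
positive index one over `ℝ³` iff Castelnuovo–Severi holds for every real `D(f)` — both being Weil
positivity (the two cc-3 readings of the located inequality agree). -/
theorem exists_hodge_lefschetz_data_iff_forall_castelnuovoSeveri :
    (∃ (I : LinearMap.BilinForm ℝ (ℝ × ℝ × ℝ)) (e₁ e₂ : ℝ × ℝ × ℝ) (corr : (ℝ → ℂ) → ℝ × ℝ × ℝ),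
        (∀ x y, I x y = I y x) ∧ I e₁ e₁ = 0 ∧ I e₂ e₂ = 0 ∧ I e₁ e₂ = 1 ∧
        (∀ g, IsWeilTest g → (∀ t, conj (g t) = g t) → I (corr g) e₁ = (weilMellin g 1).re) ∧
        (∀ g, IsWeilTest g → (∀ t, conj (g t) = g t) → I (corr g) e₂ = (weilMellin g 0).re) ∧
        (∀ g, IsWeilTest g → (∀ t, conj (g t) = g t) →
          I (corr g) (corr g) =
            2 * (weilMellin g 0).re * (weilMellin g 1).re - (weilQuadratic g).re) ∧
        ∀ D, I D (e₁ + e₂) = 0 → I D D ≤ 0) ↔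
      ∀ u : ℝ → ℝ, IsWeilTest (fun t ↦ (u t : ℂ)) →
        2 * ccPairing (toMul u) (toMul u) ≤ 2 * (massDstar (toMul u) * massDu (toMul u)) :=
  doors_tfae.out 3 4

end Summit.RiemannHypothesis.RiemannHypothesis.Theorems.MotivicDoor.ThreeCarriers

end
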